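import Summits.SmoothPoincare4.SmoothPoincare4.Theorems.SymplecticOrigamiGromovRecognitionRelEndWedgeCoordinateH
import Summits.SmoothPoincare4.SmoothPoincare4.Theorems.SymplecticOrigamiGromovRecognitionRelEndWedgeCoordinateConsistentV
import Mathlib.Geometry.Manifold.LocalDiffeomorph
import Mathlib.Analysis.Complex.Basic

/-!
# One holomorphic coordinate `T = p 0 + i p 1` near the sphere at infinity `V∞` of the wedge cap
(registered helper `helper_wedgeCoordinateV` of line `cross-cap-laurent`, crux
`GromovRecognitionRelEnd`, item stmt-SmoothPoincare4-11009)

In the wedge cap `X` (almost complex structure `JX`) the second sphere at infinity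
`V∞ = ηV (0 × ℂ) ∪ {ηC 0}` is covered by the two cap charts
`ηV : D_V = {|(p 0, p 1)| < R₁⁻¹} → X` and
`ηC : D_C = {|(p 0, p 1)| < R₁⁻¹, |(p 2, p 3)| < R₁⁻¹} → X` (injective `C^∞` local
diffeomorphisms intertwining `i ⊕ i` with `JX`).  This file produces ONE function `T : X → ℂ` on
the open neighbourhood `U_V = ηV '' D_V ∪ ηC '' D_C` of `V∞` which is `C^∞`, `JX`-holomorphic
(`dT (JX w) = i · dT w`), reads `T (ηV p) = p 0 + i p 1`,
`T (ηC p) = p 0 + i p 1` in both charts, and whose zero set in `U_V` is exactly `V∞`.  Intersections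
of `JX`-curves with `V∞` thereby become zeros of the holomorphic function `T ∘ u`.  This is the
mirror of `helper_wedgeCoordinateH` (file `…WedgeCoordinateH`) with the two complex factors swapped.

Construction: `T_V := (p 0 + i p 1) ∘ ηV⁻¹` on `ηV '' D_V` and `T_C := (p 0 + i p 1) ∘ ηC⁻¹` on
`ηC '' D_C` are smooth and `JX`-holomorphic (`helper_chartCoordinatesHolomorphic`); they agree on
the overlap of the two (open) images (`helper_wedgeCoordinateConsistentV`), so the function defined
by cases, `T y = T_V y` on `ηV '' D_V` and `T y = T_C y` otherwise, coincides with `T_V` near every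
point of `ηV '' D_V` and with `T_C` near every point of `ηC '' D_C`; smoothness and holomorphicity
are local (`WedgeCoordinateH.contMDiffAt_and_hol_of_eqOn`).  The zero set is read off the chart
values and the gluing clause `ηC = ηV ∘ inv₂` off the second axis.

Everything is proved; no definition, no named fact.

References: D. McDuff, D. Salamon, *Introduction to Symplectic Topology*, 3rd ed. (2017), §2.5,
§4.5 [McDuffSalamon2017]; M. Gromov, *Pseudo holomorphic curves in symplectic manifolds*,
Invent. Math. 82 (1985), 2.4.A₁′ [Gromov1985].
-/

-- the registered namespace `Summit.SmoothPoincare4.SmoothPoincare4.Theorems…` repeats a component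
set_option linter.dupNamespace false

open scoped Manifold ContDiff Topology
open Set Function Filter

namespace Summit.SmoothPoincare4.SmoothPoincare4.Theorems.GromovRecognitionRelEnd.CrossCapLaurent

open WedgeCoordinateH in
/-- **Registered helper `helper_wedgeCoordinateV`** (line `cross-cap-laurent`, signature verbatim):
one holomorphic coordinate near `V∞`.  For the cap charts `ηV`, `ηC` of the wedge cap (injective
`C^∞` local diffeomorphisms on their polydiscs intertwining `i ⊕ i` with `JX`, glued to `ι ∘ χ`, to
`ηH` and to each other by the complex inversions of one factor, with the `H`-axis points and the
corner `ηC 0` outside `range ι` and the two axis images disjoint) there is `T : X → ℂ`, `C^∞` and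
`JX`-holomorphic on the open set `U_V = ηV '' D_V ∪ ηC '' D_C`, with `T (ηV p) = p 0 + i p 1`,
`T (ηC p) = p 0 + i p 1`, and `{y ∈ U_V | T y = 0} = ηV (0 × ℂ) ∪ {ηC 0} = V∞`.  See the file header
for the construction. [cite: McDuffSalamon2017, §2.5] -/
theorem helper_wedgeCoordinateV : ∀ (M : Type) (X : Type) [TopologicalSpace X] [T2Space X] [ChartedSpace (EuclideanSpace ℝ (Fin 4)) X] [IsManifold (𝓡 4) ∞ X] (JX : ∀ y : X, TangentSpace (𝓡 4) y →L[ℝ] TangentSpace (𝓡 4) y) (R₁ : ℝ) (χ : EuclideanSpace ℝ (Fin 4) → M) (ι : M → X) (ηH ηV ηC : EuclideanSpace ℝ (Fin 4) → X), 0 < R₁ → IsLocalDiffeomorphOn 𝓘(ℝ, EuclideanSpace ℝ (Fin 4)) (𝓡 4) ∞ ηV {p : EuclideanSpace ℝ (Fin 4) | p 0 ^ 2 + p 1 ^ 2 < R₁⁻¹ ^ 2} → Set.InjOn ηV {p : EuclideanSpace ℝ (Fin 4) | p 0 ^ 2 + p 1 ^ 2 < R₁⁻¹ ^ 2} → (∀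 p : EuclideanSpace ℝ (Fin 4), p 0 ^ 2 + p 1 ^ 2 < R₁⁻¹ ^ 2 → ∀ q : EuclideanSpace ℝ (Fin 4), JX (ηV p) (mfderiv 𝓘(ℝ, EuclideanSpace ℝ (Fin 4)) (𝓡 4) ηV p q) = mfderiv 𝓘(ℝ, EuclideanSpace ℝ (Fin 4)) (𝓡 4) ηV p (WithLp.toLp 2 ![-(q 1), q 0, -(q 3), q 2])) → IsLocalDiffeomorphOn 𝓘(ℝ, EuclideanSpace ℝ (Fin 4)) (𝓡 4) ∞ ηC {p : EuclideanSpace ℝ (Fin 4) | p 0 ^ 2 + p 1 ^ 2 < R₁⁻¹ ^ 2 ∧ p 2 ^ 2 + p 3 ^ 2 < R₁⁻¹ ^ 2} → Set.InjOn ηC {p : EuclideanSpace ℝ (Fin 4) | p 0 ^ 2 + p 1 ^ 2 < R₁⁻¹ ^ 2 ∧ p 2 ^ 2 + p 3 ^ 2 < R₁⁻¹ ^ 2} → (∀ p : EuclideanSpace ℝ (Fin 4), p 0 ^ 2 + p 1 ^ 2 < R₁⁻¹ ^ 2 → p 2 ^ 2 + p 3 ^ 2 < R₁⁻¹ ^ 2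 → ∀ q : EuclideanSpace ℝ (Fin 4), JX (ηC p) (mfderiv 𝓘(ℝ, EuclideanSpace ℝ (Fin 4)) (𝓡 4) ηC p q) = mfderiv 𝓘(ℝ, EuclideanSpace ℝ (Fin 4)) (𝓡 4) ηC p (WithLp.toLp 2 ![-(q 1), q 0, -(q 3), q 2])) → (∀ p : EuclideanSpace ℝ (Fin 4), p 0 ^ 2 + p 1 ^ 2 < R₁⁻¹ ^ 2 → (p 0 ≠ 0 ∨ p 1 ≠ 0) → ηV p = ι (χ (WithLp.toLp 2 ![p 0 / (p 0 ^ 2 + p 1 ^ 2), -(p 1) / (p 0 ^ 2 + p 1 ^ 2), p 2, p 3]))) → (∀ p : EuclideanSpace ℝ (Fin 4), p 2 = 0 → p 3 = 0 → ηH p ∉ Set.range ι) → (∀ p : EuclideanSpace ℝ (Fin 4), p 0 ^ 2 + p 1 ^ 2 < R₁⁻¹ ^ 2 → p 2 ^ 2 + p 3 ^ 2 < R₁⁻¹ ^ 2 → (p 0 ≠ 0 ∨ p 1 ≠ 0) → ηC p = ηH (WithLp.toLp 2 ![p 0 / (p 0 ^ 2 + p 1 ^ 2), -(p 1) / (p 0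 ^ 2 + p 1 ^ 2), p 2, p 3])) → (∀ p : EuclideanSpace ℝ (Fin 4), p 0 ^ 2 + p 1 ^ 2 < R₁⁻¹ ^ 2 → p 2 ^ 2 + p 3 ^ 2 < R₁⁻¹ ^ 2 → (p 2 ≠ 0 ∨ p 3 ≠ 0) → ηC p = ηV (WithLp.toLp 2 ![p 0, p 1, p 2 / (p 2 ^ 2 + p 3 ^ 2), -(p 3) / (p 2 ^ 2 + p 3 ^ 2)])) → ηC 0 ∉ Set.range ι → (∀ p q : EuclideanSpace ℝ (Fin 4), p 2 = 0 → p 3 = 0 → q 0 = 0 → q 1 = 0 → ηH p ≠ ηV q) → ∃ T : X → ℂ, IsOpen (ηV '' {p : EuclideanSpace ℝ (Fin 4) | p 0 ^ 2 + p 1 ^ 2 < R₁⁻¹ ^ 2} ∪ ηC '' {p : EuclideanSpace ℝ (Fin 4) | p 0 ^ 2 + p 1 ^ 2 < R₁⁻¹ ^ 2 ∧ p 2 ^ 2 + p 3 ^ 2 < R₁⁻¹ ^ 2}) ∧ ContMDiffOn (𝓡 4) 𝓘(ℝ, ℂ) ∞ T (ηV '' {p : EuclideanSpace ℝ (Fin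 4) | p 0 ^ 2 + p 1 ^ 2 < R₁⁻¹ ^ 2} ∪ ηC '' {p : EuclideanSpace ℝ (Fin 4) | p 0 ^ 2 + p 1 ^ 2 < R₁⁻¹ ^ 2 ∧ p 2 ^ 2 + p 3 ^ 2 < R₁⁻¹ ^ 2}) ∧ (∀ y ∈ ηV '' {p : EuclideanSpace ℝ (Fin 4) | p 0 ^ 2 + p 1 ^ 2 < R₁⁻¹ ^ 2} ∪ ηC '' {p : EuclideanSpace ℝ (Fin 4) | p 0 ^ 2 + p 1 ^ 2 < R₁⁻¹ ^ 2 ∧ p 2 ^ 2 + p 3 ^ 2 < R₁⁻¹ ^ 2}, ∀ w : TangentSpace (𝓡 4) y, (show ℂ from mfderiv (𝓡 4) 𝓘(ℝ, ℂ) T y (JX y w)) = Complex.I * (show ℂ from mfderiv (𝓡 4) 𝓘(ℝ, ℂ) T y w)) ∧ (∀ p : EuclideanSpace ℝ (Fin 4), p 0 ^ 2 + p 1 ^ 2 < R₁⁻¹ ^ 2 → T (ηV p) = ⟨p 0, p 1⟩) ∧ (∀ p : EuclideanSpace ℝ (Fin 4), p 0 ^ 2 + p 1 ^ 2 < R₁⁻¹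 ^ 2 → p 2 ^ 2 + p 3 ^ 2 < R₁⁻¹ ^ 2 → T (ηC p) = ⟨p 0, p 1⟩) ∧ {y : X | y ∈ (ηV '' {p : EuclideanSpace ℝ (Fin 4) | p 0 ^ 2 + p 1 ^ 2 < R₁⁻¹ ^ 2} ∪ ηC '' {p : EuclideanSpace ℝ (Fin 4) | p 0 ^ 2 + p 1 ^ 2 < R₁⁻¹ ^ 2 ∧ p 2 ^ 2 + p 3 ^ 2 < R₁⁻¹ ^ 2}) ∧ T y = 0} = Set.range (fun z : ℂ => ηV (WithLp.toLp 2 ![0, 0, z.re, z.im])) ∪ {ηC 0} := by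
  intro M X _ _ _ _ JX R₁ χ ι ηH ηV ηC hR₁ hVloc hVinj hVhol hCloc hCinj hChol hVglue hHax hCH hCV
    hC0 hdisj
  classical
  -- the two coordinate polydiscs
  set DV : Set (EuclideanSpace ℝ (Fin 4)) :=
    {p : EuclideanSpace ℝ (Fin 4) | p 0 ^ 2 + p 1 ^ 2 < R₁⁻¹ ^ 2} with hDV
  set DC : Set (EuclideanSpace ℝ (Fin 4)) :=
    {p : EuclideanSpace ℝ (Fin 4) | p 0 ^ 2 + p 1 ^ 2 < R₁⁻¹ ^ 2 ∧ p 2 ^ 2 + p 3 ^ 2 < R₁⁻¹ ^ 2}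
    with hDC
  have hR : (0 : ℝ) < R₁⁻¹ ^ 2 := by positivity
  have hc : ∀ i : Fin 4, Continuous fun p : EuclideanSpace ℝ (Fin 4) => p i := fun i =>
    (continuous_apply i).comp (PiLp.continuous_ofLp 2 _)
  have hr1 : Continuous fun p : EuclideanSpace ℝ (Fin 4) => p 0 ^ 2 + p 1 ^ 2 :=
    ((hc 0).pow 2).add ((hc 1).pow 2)
  have hr2 : Continuous fun p : EuclideanSpace ℝ (Fin 4) => p 2 ^ 2 + p 3 ^ 2 :=
    ((hc 2).pow 2).add ((hc 3).pow 2)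
  have hDVo : IsOpen DV := isOpen_lt hr1 continuous_const
  have hDCo : IsOpen DC := (isOpen_lt hr1 continuous_const).and (isOpen_lt hr2 continuous_const)
  -- the first complex coordinate read through `ηV` and through `ηC`: smooth, `JX`-holomorphic
  obtain ⟨hUVo, hTV, -, hTVhol, -⟩ := helper_chartCoordinatesHolomorphic X JX ηV DV hDVo hVloc hVinj
    (fun p hp q => hVhol p hp q)
  obtain ⟨hUCo, hTC, -, hTChol, -⟩ := helper_chartCoordinatesHolomorphic X JX ηC DC hDCo hCloc hCinj
    (fun p hp q => hChol p hp.1 hp.2 q)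
  set TV : X → ℂ :=
    (fun y => (⟨(Function.invFunOn ηV DV y) 0, (Function.invFunOn ηV DV y) 1⟩ : ℂ)) with hTVdef
  set TC : X → ℂ :=
    (fun y => (⟨(Function.invFunOn ηC DC y) 0, (Function.invFunOn ηC DC y) 1⟩ : ℂ)) with hTCdef
  have hTVval : ∀ p ∈ DV, TV (ηV p) = ⟨p 0, p 1⟩ := fun p hp => by
    simp only [hTVdef]
    rw [hVinj.leftInvOn_invFunOn hp]
  have hTCval : ∀ p ∈ DC, TC (ηC p) = ⟨p 0, p 1⟩ := fun p hp => by
    simp only [hTCdef]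
    rw [hCinj.leftInvOn_invFunOn hp]
  -- the two readings agree on the overlap of the chart images
  have hcons : ∀ y ∈ ηV '' DV, y ∈ ηC '' DC → TV y = TC y := by
    rintro _ ⟨p, hp, rfl⟩ ⟨p', hp', he⟩
    obtain ⟨h0, h1⟩ := helper_wedgeCoordinateConsistentV M X R₁ χ ι ηH ηV ηC hVinj hVglue hHax hCH
      hCV hC0 hdisj p p' hp hp'.1 hp'.2 he.symm
    rw [hTVval p hp, ← he, hTCval p' hp', h0, h1]
  -- the glued coordinate `T`
  obtain ⟨T, hT⟩ : ∃ T : X → ℂ, ∀ y, T y = if y ∈ ηV '' DV then TV y else TC y :=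
    ⟨fun y => if y ∈ ηV '' DV then TV y else TC y, fun _ => rfl⟩
  have hT_V : ∀ y ∈ ηV '' DV, T y = TV y := fun y hy => by rw [hT, if_pos hy]
  have hT_C : ∀ y ∈ ηC '' DC, T y = TC y := fun y hy => by
    by_cases h : y ∈ ηV '' DV
    · rw [hT_V y h]
      exact hcons y h hy
    · rw [hT, if_neg h]
  have hvalV : ∀ p ∈ DV, T (ηV p) = ⟨p 0, p 1⟩ := fun p hp => by
    rw [hT_V _ ⟨p, hp, rfl⟩, hTVval p hp]
  have hvalC : ∀ p ∈ DC, T (ηC p) = ⟨p 0, p 1⟩ := fun p hp => by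
    rw [hT_C _ ⟨p, hp, rfl⟩, hTCval p hp]
  refine ⟨T, hUVo.union hUCo, ?_, ?_, fun p hp => hvalV p hp,
    fun p hp₁ hp₂ => hvalC p ⟨hp₁, hp₂⟩, ?_⟩
  · -- smoothness is local: `T = T_V` near `ηV '' D_V`, `T = T_C` near `ηC '' D_C` (both open)
    rintro y (hy | hy)
    · exact (contMDiffAt_and_hol_of_eqOn hUVo hTV hTVhol hT_V hy).1.contMDiffWithinAt
    · exact (contMDiffAt_and_hol_of_eqOn hUCo hTC hTChol hT_C hy).1.contMDiffWithinAt
  · -- and so is holomorphicity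
    rintro y (hy | hy) w
    · exact (contMDiffAt_and_hol_of_eqOn hUVo hTV hTVhol hT_V hy).2 w
    · exact (contMDiffAt_and_hol_of_eqOn hUCo hTC hTChol hT_C hy).2 w
  · -- the zero set of `T` in `U_V` is `V∞ = ηV (0 × ℂ) ∪ {ηC 0}`
    ext y
    simp only [mem_setOf_eq, mem_union, mem_range, mem_singleton_iff]
    constructor
    · rintro ⟨hy | hy, hT0⟩
      · -- `y = ηV p` with `p 0 = p 1 = 0`: a point of the affine part `ηV (0 × ℂ)`
        obtain ⟨p, hp, rfl⟩ := hy
        rw [hvalV p hp] at hT0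
        have h0 : p 0 = 0 := by simpa using congrArg Complex.re hT0
        have h1 : p 1 = 0 := by simpa using congrArg Complex.im hT0
        refine Or.inl ⟨⟨p 2, p 3⟩, ?_⟩
        show ηV _ = ηV p
        congr 1
        ext i
        fin_cases i <;> simp [h0, h1]
      · -- `y = ηC p` with `p 0 = p 1 = 0`: off the second axis `ηC p = ηV (0, 1 / z₂)`,
        -- else `p = 0`
        obtain ⟨p, hp, rfl⟩ := hy
        rw [hvalC p hp] at hT0
        have h0 : p 0 = 0 := by simpa using congrArg Complex.re hT0
        have h1 : p 1 = 0 := by simpa using congrArg Complex.im hT0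
        by_cases h23 : p 2 ≠ 0 ∨ p 3 ≠ 0
        · refine Or.inl ⟨⟨p 2 / (p 2 ^ 2 + p 3 ^ 2), -(p 3) / (p 2 ^ 2 + p 3 ^ 2)⟩, ?_⟩
          show ηV _ = ηC p
          rw [hCV p hp.1 hp.2 h23]
          congr 1
          ext i
          fin_cases i <;> simp [h0, h1]
        · simp only [not_or, not_not] at h23
          have hp0 : p = 0 := by
            ext i
            fin_cases i <;> simp [h0, h1, h23.1, h23.2]
          exact Or.inr (congrArg ηC hp0)
    · rintro (⟨z, rfl⟩ | rfl)
      · -- the affine part: `ηV (0, z) ∈ ηV '' D_V` and `T = 0 + i 0` there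
        have hmem : (WithLp.toLp 2 ![0, 0, z.re, z.im] : EuclideanSpace ℝ (Fin 4)) ∈ DV := by
          rw [hDV]
          simpa using hR
        exact ⟨Or.inl ⟨_, hmem, rfl⟩, by rw [hvalV _ hmem]; simp [Complex.ext_iff]⟩
      · -- the point at infinity `ηC 0`
        have hmem : (0 : EuclideanSpace ℝ (Fin 4)) ∈ DC := by
          rw [hDC]
          simpa using hR
        exact ⟨Or.inr ⟨0, hmem, rfl⟩, by rw [hvalC 0 hmem]; simp [Complex.ext_iff]⟩

end Summit.SmoothPoincare4.SmoothPoincare4.Theorems.GromovRecognitionRelEnd.CrossCapLaurent
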